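import Summits.CriticalPhenomena.PercolationContinuityZ3.Theorems.Transplant.SkelNegParamsLatticeA
import Summits.CriticalPhenomena.PercolationContinuityZ3.Theorems.Transplant.SkelNegParamsFineMult
import HarnessLib

/-!
# N1 params, part FineMult-A (q-free, consumer-independent): THE FINE MULTIPLIERS WITH THE COARSE-LATTICE CONSTANT `A` AS A PARAMETER —
# `mOfA₀ A K n h ℓ v_α := ⌊D_A/(20K·(A·L̂₀))⌋`, `mOfA₁ := ⌊D_A/(20K·(A·L̂₁))⌋` (`D_A = A²·modulus`, `L̂₀ = |v_β| + |v_α|`, `L̂₁ = n + |h|`), the resolution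
# inequalities `c_i·L_i ≤ D_A` BY DEFINITION, and `s ≤ mOfA_i` from the ledger floors for EVERY `A ≥ 800` (stmt-g16 2026-08-22; (ζ′), twin of
# `SkelNegParamsFineMult` p275734 with `800 ↦ A`; at `A := 20·K` the multipliers are `⌊modulus/L̂_i⌋`)
builds on p205010 (kernel theorem, internal audit signed; external expert review pending) — nothing in this file uses p205010; NOTHING is claimed about the node
`SamePDropOfSkeletonNeg₁` (OPEN).
Lane `prim-bschramm-*`, seat `prim-bschramm-stmt` (gen 16); helper file (`--supports stmt-CriticalPhenomena-4575 --as helper`); ledger HOME/prim-bschramm-stmt/NEG-PARAMS.md.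
* §1 **`mOfA₀`**, **`mOfA₁`**, `absA_mul_LhatA`, `mOfA_eq_eight_hundred`; §2 `mOfA_nonneg`, **`cL_le_DA₀/₁`**, **`le_mOfA₁`**, **`le_mOfA₀`** (`800 ≤ A`), `two_le_mOfA`,
  `le_mOfA_both`; §3 `mOfA_eq_of_twentyK` (`A = 20K`: `mOfA_i = ⌊modulus/L̂_i⌋`).
[cite: MartineauTassion2017, §4.3 (the cell lattice)] [cite: KozmaNitzan2024, §4 pp. 25–26 (two-unit cells)]
-/

namespace Summit.CriticalPhenomena.PercolationContinuityZ3.Theorems.Transplant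

namespace Skelφ

namespace NegPrm

open Literature.Probability.LatticeModels TwoAxis.Para

/-! ## §1 The multipliers -/

/-- **The fine multiplier of axis 0 at lattice constant `A`**: `⌊D_A / (20K·(A·L̂₀))⌋`. [this work] -/
def mOfA₀ (A : ℤ) (K n : ℕ) (h : ℤ) (ℓ : ℕ) (vα : ℤ) : ℤ := DofA A n h ℓ vα / (20 * (K : ℤ) * (A * L0hat n h ℓ vα))

/-- **The fine multiplier of axis 1 at lattice constant `A`**: `⌊D_A / (20K·(A·L̂₁))⌋`. [this work] -/
def mOfA₁ (A : ℤ) (K n : ℕ) (h : ℤ) (ℓ : ℕ) (vα : ℤ) : ℤ := DofA A n h ℓ vα / (20 * (K : ℤ) * (A * L1hat n h))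

/-- `L̂₀` and `L̂₁` in the `|A|·(…)` shape of hp-8's lemmas (`0 ≤ A`). [folklore] -/
theorem absA_mul_LhatA {A : ℤ} (hA : 0 ≤ A) (n : ℕ) (h : ℤ) (ℓ : ℕ) (vα : ℤ) :
    |A| * (|vβOf n h ℓ vα| + |vα|) = A * L0hat n h ℓ vα ∧ |A| * (|(n : ℤ)| + |h|) = A * L1hat n h := by
  rw [abs_of_nonneg hA, abs_of_nonneg (by positivity : (0 : ℤ) ≤ (n : ℤ))]
  exact ⟨rfl, rfl⟩

/-- The ledger's multipliers are the `A = 800` instances. [folklore] -/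
theorem mOfA_eq_eight_hundred (K n : ℕ) (h : ℤ) (ℓ : ℕ) (vα : ℤ) :
    mOf₀ K n h ℓ vα = mOfA₀ 800 K n h ℓ vα ∧ mOf₁ K n h ℓ vα = mOfA₁ 800 K n h ℓ vα := ⟨rfl, rfl⟩

/-! ## §2 The facts -/

/-- `0 ≤ mOfA₀` and `0 ≤ mOfA₁` (`0 < A`, `1 ≤ n`, `1 ≤ ℓ`). [folklore] -/
theorem mOfA_nonneg {A : ℤ} (hA : 0 < A) {K n ℓ : ℕ} (hn : 1 ≤ n) (hℓ : 1 ≤ ℓ) (h vα : ℤ) :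
    0 ≤ mOfA₀ A K n h ℓ vα ∧ 0 ≤ mOfA₁ A K n h ℓ vα := by
  have hD := (DofA_pos hA.ne' hn hℓ h vα).le
  have h0 := (Lhat_nonneg n h ℓ vα).1
  have h1 := (Lhat_nonneg n h ℓ vα).2
  exact ⟨Int.ediv_nonneg hD (by positivity), Int.ediv_nonneg hD (by positivity)⟩

/-- **`c₀·L₀ ≤ D_A` by definition**: `(20K·mOfA₀)·(|A|·(|v_β| + |v_α|)) ≤ D_A` (`0 < A`, `1 ≤ n`, `1 ≤ ℓ`). [folklore] -/
theorem cL_le_DA₀ {A : ℤ} (hA : 0 < A) {K n ℓ : ℕ} (hn : 1 ≤ n) (hℓ : 1 ≤ ℓ) (h vα : ℤ) :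
    20 * (K : ℤ) * mOfA₀ A K n h ℓ vα * (|A| * (|vβOf n h ℓ vα| + |vα|)) ≤ DofA A n h ℓ vα := by
  rw [(absA_mul_LhatA hA.le n h ℓ vα).1]
  have hD := (DofA_pos hA.ne' hn hℓ h vα).le
  set X : ℤ := 20 * (K : ℤ) * (A * L0hat n h ℓ vα) with hX
  rcases eq_or_ne X 0 with h0 | h0
  · have : 20 * (K : ℤ) * mOfA₀ A K n h ℓ vα * (A * L0hat n h ℓ vα) = mOfA₀ A K n h ℓ vα * X := by rw [hX]; ring
    rw [this, h0, mul_zero]; exact hD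
  · have e : 20 * (K : ℤ) * mOfA₀ A K n h ℓ vα * (A * L0hat n h ℓ vα) = DofA A n h ℓ vα / X * X := by rw [mOfA₀, ← hX]; ring
    rw [e]; exact Int.ediv_mul_le _ h0

/-- **`c₁·L₁ ≤ D_A` by definition**: `(20K·mOfA₁)·(|A|·(|n| + |h|)) ≤ D_A` (`0 < A`, `1 ≤ n`, `1 ≤ ℓ`). [folklore] -/
theorem cL_le_DA₁ {A : ℤ} (hA : 0 < A) {K n ℓ : ℕ} (hn : 1 ≤ n) (hℓ : 1 ≤ ℓ) (h vα : ℤ) :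
    20 * (K : ℤ) * mOfA₁ A K n h ℓ vα * (|A| * (|(n : ℤ)| + |h|)) ≤ DofA A n h ℓ vα := by
  rw [(absA_mul_LhatA hA.le n h ℓ vα).2]
  have hD := (DofA_pos hA.ne' hn hℓ h vα).le
  set X : ℤ := 20 * (K : ℤ) * (A * L1hat n h) with hX
  rcases eq_or_ne X 0 with h0 | h0
  · have : 20 * (K : ℤ) * mOfA₁ A K n h ℓ vα * (A * L1hat n h) = mOfA₁ A K n h ℓ vα * X := by rw [hX]; ring
    rw [this, h0, mul_zero]; exact hD
  · have e : 20 * (K : ℤ) * mOfA₁ A K n h ℓ vα * (A * L1hat n h) = DofA A n h ℓ vα / X * X := by rw [mOfA₁, ← hX]; ring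
    rw [e]; exact Int.ediv_mul_le _ h0

/-- **`s ≤ mOfA₁` from the floor `K·s + 2 ≤ M`**, any `A ≥ 800` (`hL1_of_floorsA`; `1 ≤ K`). [this work] -/
theorem le_mOfA₁ {A : ℤ} (hA : 800 ≤ A) {K : ℕ} (hK1 : 1 ≤ K) {s M : ℤ} {n ℓ : ℕ} {h : ℤ} (vα : ℤ) (hs : 0 ≤ s) (hM : (K : ℤ) * s + 2 ≤ M)
    (hn : M + 1 ≤ n) (hℓ : M + 1 ≤ ℓ) (hlay₁ : (M + 1) * ((n : ℤ) + |h|) ≤ (n : ℤ) * ((ℓ : ℤ) + 1)) : s ≤ mOfA₁ A K n h ℓ vα := by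
  have hK : (0 : ℤ) ≤ K := by positivity
  have hA0 : 0 ≤ A := by linarith
  have hn1 : 1 ≤ n := (one_le_of_floor (mul_nonneg hK hs) hM hn hℓ).1
  have hL := hL1_of_floorsA hA hK hs hM hn hℓ hlay₁ (modulus_vβOf_layer hn1 h ℓ vα)
  rw [one_mul, (absA_mul_LhatA hA0 n h ℓ vα).2] at hL
  have hL1 : (1 : ℤ) ≤ L1hat n h := by
    have h1 := abs_nonneg h
    have h2 : (1 : ℤ) ≤ n := by exact_mod_cast hn1
    unfold L1hat; linarith
  have hK1' : (1 : ℤ) ≤ K := by exact_mod_cast hK1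
  have hA1 : (1 : ℤ) ≤ A := by linarith
  have hX : 0 < 20 * (K : ℤ) * (A * L1hat n h) := by positivity
  unfold mOfA₁ DofA
  refine Int.le_ediv_of_mul_le hX ?_
  have e : s * (20 * (K : ℤ) * (A * L1hat n h)) = 20 * K * (A * L1hat n h * s) := by ring
  rw [e]; exact hL

/-- **`s ≤ mOfA₀` from the floor `4K·s + 2 ≤ M`**, `|v_α| ≤ n`, any `A ≥ 800` (`hL0_of_floorsA`; `1 ≤ K`). [this work] -/
theorem le_mOfA₀ {A : ℤ} (hA : 800 ≤ A) {K : ℕ} (hK1 : 1 ≤ K) {s M : ℤ} {n ℓ : ℕ} {h vα : ℤ} (hs : 0 ≤ s) (hM : 4 * (K : ℤ) * s + 2 ≤ M)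
    (hn : M + 1 ≤ n) (hℓ : M + 1 ≤ ℓ) (hlay₁ : (M + 1) * ((n : ℤ) + |h|) ≤ (n : ℤ) * ((ℓ : ℤ) + 1)) (hv : |vα| ≤ (n : ℤ)) :
    s ≤ mOfA₀ A K n h ℓ vα := by
  have hK : (0 : ℤ) ≤ K := by positivity
  have hA0 : 0 ≤ A := by linarith
  have hn1 := one_le_of_floor (by positivity : (0 : ℤ) ≤ 4 * K * s) hM hn hℓ
  have hlay := modulus_vβOf_layer hn1.1 h ℓ vα
  have hL := hL0_of_floorsA hA hK hs hM hn hℓ hlay₁ hv hlay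
  rw [one_mul, (absA_mul_LhatA hA0 n h ℓ vα).1] at hL
  -- `L̂₀ ≥ 1`: `(v_α, v_β) ≠ 0` since `modulus > 0`
  have hL0 : (1 : ℤ) ≤ L0hat n h ℓ vα := by
    have hpos := modulus_vβOf_pos hn1.1 hn1.2 h vα
    unfold L0hat
    by_contra hc
    push Not at hc
    have ha : |vβOf n h ℓ vα| = 0 := by linarith [abs_nonneg (vβOf n h ℓ vα), abs_nonneg vα]
    have hb : |vα| = 0 := by linarith [abs_nonneg (vβOf n h ℓ vα), abs_nonneg vα]
    rw [abs_eq_zero] at ha hb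
    unfold modulus at hpos
    rw [ha, hb] at hpos
    simp at hpos
  have hK1' : (1 : ℤ) ≤ K := by exact_mod_cast hK1
  have hA1 : (1 : ℤ) ≤ A := by linarith
  have hX : 0 < 20 * (K : ℤ) * (A * L0hat n h ℓ vα) := by positivity
  unfold mOfA₀ DofA
  refine Int.le_ediv_of_mul_le hX ?_
  have e : s * (20 * (K : ℤ) * (A * L0hat n h ℓ vα)) = 20 * K * (A * L0hat n h ℓ vα * s) := by ring
  rw [e]; exact hL

/-- With `1 ≤ K`, `8K + 2 ≤ M` both multipliers are `≥ 2`, any `A ≥ 800`. [this work] -/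
theorem two_le_mOfA {A : ℤ} (hA : 800 ≤ A) {K : ℕ} (hK1 : 1 ≤ K) {M : ℤ} {n ℓ : ℕ} {h vα : ℤ} (hM : 8 * (K : ℤ) + 2 ≤ M) (hn : M + 1 ≤ n)
    (hℓ : M + 1 ≤ ℓ) (hlay₁ : (M + 1) * ((n : ℤ) + |h|) ≤ (n : ℤ) * ((ℓ : ℤ) + 1)) (hv : |vα| ≤ (n : ℤ)) :
    2 ≤ mOfA₀ A K n h ℓ vα ∧ 2 ≤ mOfA₁ A K n h ℓ vα :=
  ⟨le_mOfA₀ hA hK1 (by norm_num) (by linarith) hn hℓ hlay₁ hv, le_mOfA₁ hA hK1 vα (by norm_num) (by linarith) hn hℓ hlay₁⟩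

/-- Both multipliers dominate any `s ≥ 0` with `4K·s + 2 ≤ M`, any `A ≥ 800`. [folklore] -/
theorem le_mOfA_both {A : ℤ} (hA : 800 ≤ A) {K : ℕ} (hK1 : 1 ≤ K) {s M : ℤ} {n ℓ : ℕ} {h vα : ℤ} (hs : 0 ≤ s) (hM : 4 * (K : ℤ) * s + 2 ≤ M)
    (hn : M + 1 ≤ n) (hℓ : M + 1 ≤ ℓ) (hlay₁ : (M + 1) * ((n : ℤ) + |h|) ≤ (n : ℤ) * ((ℓ : ℤ) + 1)) (hv : |vα| ≤ (n : ℤ)) :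
    s ≤ mOfA₀ A K n h ℓ vα ∧ s ≤ mOfA₁ A K n h ℓ vα :=
  ⟨le_mOfA₀ hA hK1 hs hM hn hℓ hlay₁ hv, le_mOfA₁ hA hK1 vα hs (by nlinarith [mul_nonneg (by positivity : (0 : ℤ) ≤ K) hs]) hn hℓ hlay₁⟩

/-! ## §3 The value at `A = 20·K` -/

/-- **At `A = 20·K` the multipliers are `⌊modulus/L̂_i⌋`** (`1 ≤ K`): the (ζ′) reading 'Kq dropped from the divisor'. [this work] -/
theorem mOfA_eq_of_twentyK {A : ℤ} {K : ℕ} (hK1 : 1 ≤ K) (hAK : A = 20 * (K : ℤ)) (n : ℕ) (h : ℤ) (ℓ : ℕ) (vα : ℤ) :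
    mOfA₀ A K n h ℓ vα = modulus n h vα (vβOf n h ℓ vα) / L0hat n h ℓ vα ∧ mOfA₁ A K n h ℓ vα = modulus n h vα (vβOf n h ℓ vα) / L1hat n h := by
  have hK0 : (0 : ℤ) < K := by exact_mod_cast hK1
  have hA : 0 < A := by rw [hAK]; positivity
  have e : ∀ L : ℤ, 20 * (K : ℤ) * (A * L) = A ^ 2 * L := by intro L; rw [hAK]; ring
  have hA2 : 0 < A ^ 2 := by positivity
  unfold mOfA₀ mOfA₁ DofA detD
  rw [e, e, Int.mul_ediv_mul_of_pos _ _ hA2, Int.mul_ediv_mul_of_pos _ _ hA2]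
  exact ⟨rfl, rfl⟩

end NegPrm

end Skelφ

end Summit.CriticalPhenomena.PercolationContinuityZ3.Theorems.Transplant
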